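import Summits.NavierStokesRegularity.NavierStokesRegularity.Theorems.PerpetualPumpAveragedTypeIBlowupPreBootModes
import Summits.NavierStokesRegularity.NavierStokesRegularity.Theorems.PerpetualPumpAveragedTypeIBlowupPreBootRegime
import Summits.NavierStokesRegularity.NavierStokesRegularity.Theorems.PerpetualPumpAveragedTypeIBlowupLevelOnePreTools
import Summits.NavierStokesRegularity.NavierStokesRegularity.Theorems.PerpetualPumpAveragedTypeIBlowupPreviousPair
import Summits.NavierStokesRegularity.NavierStokesRegularity.Theorems.PerpetualPumpAveragedTypeIBlowupPulseBootPrev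

/-!
# Crux `PerpetualPump.AveragedTypeIBlowup` (stmt-NavierStokesRegularity-1835), line `Sketch`:
# stub `preBoot` — the previous pair under the loose induction hypothesis

Sixth file of the proof of the registered stub `stub_preBoot`. On a pre-ignition horizon
`[t₀, S]` the pair one scale behind the front relaxes as in `stub_previousPairTrunc`
(`preBoot_prevPair`, registered tools sub-goal; relative rate `(1+ε₀)⁻²`, `ω = 1/100`,
`Λ = Λ₀ = 100 + 4 log(b_hi + 5)`, `σ_I = 2Λ₀/B`, `μ = 5(b_hi+4)²`), fed by the tight trail bond
below and the loose front carrier; its majorants stay below `6(b_hi+4)²` by the Duhamel restart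
inequalities and the pointwise bracket bounds `pulseBoot_prev_brackets` of `…PulseBootPrev`.

## References

T. Tao, *Finite time blowup for an averaged three-dimensional Navier–Stokes equation*, J. Amer.
Math. Soc. 29 (2016), 601–674, §5–6 (the cascade / circuit heuristics); the estimates are
folklore ODE bookkeeping.
-/

noncomputable section

-- the summit namespace `…NavierStokesRegularity.NavierStokesRegularity…` is the tree convention
set_option linter.dupNamespace false

open Set MeasureTheory Filter Topology

namespace Summit.NavierStokesRegularity.NavierStokesRegularity.Theorems.PerpetualPumpAveragedTypeIBlowup
set_option maxHeartbeats 800000 in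
/-- **The previous pair under the loose induction hypothesis.** On `[t₀, S]`
(`0 < R_n(S − t₀) ≤ 3`, `n₀ ≤ n − 1`): from the tight trail bond below (`|w_{n−2}| ≤ 1/100`) and
the loose front carrier (`b_n ∈ [−1/2, B+3]`, `b_n ≥ Be^{−σ} − 3`), the pair one scale behind
the front relaxes as in `stub_previousPairTrunc` (relative rate `(1+ε₀)⁻²`, `ω = 1/100`,
`Λ = Λ₀ = 100 + 4 log(b_hi+5)`, `σ_I = 2Λ₀/B`, `μ = 5(b_hi+4)²`, `σ₁ = 10`), and its majorants
stay below `6(b_hi+4)²` (Duhamel restart inequalities). Registered tools sub-goal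
`preBoot_prevPair` of the stub `preBoot`. [folklore] -/
theorem preBoot_prevPair :
    ∀ (ε₀ D εb θ η F blo bhi q T t₀ S B : ℝ) (n₀ n : ℤ) (bv wv M0 M1 db dw G0 G1 : ℤ → ℝ → ℝ)
      (R : ℤ → ℝ),
      (q = Real.sqrt (1 + ε₀)) →
      (∀ k : ℤ, R k = D * (1 + ε₀) ^ (2 * k)) →
      (∀ (k : ℤ) (t : ℝ), G0 k t = (wv (k - 1) t) ^ 2 / q ^ 3 - (wv k t) ^ 2 - εb * bv k t * wv k t) →
      (∀ (k : ℤ) (t : ℝ), G1 k t = wv k t * (bv k t - bv (k + 1) t / q) + εb * (bv k t) ^ 2) →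
      (0 < ε₀) →
      (ε₀ ≤ 1 / 20) →
      (0 < D) →
      (1 / 2 ≤ θ) →
      (θ ≤ 1) →
      (0 ≤ η) →
      (0 < εb) →
      (εb ≤ 1 / 10 ^ 6) →
      (10 ^ 4 + 40 - 5 * Real.log εb ≤ blo) →
      (10 ^ 9 * (bhi + 4) ^ 4 ≤ F) →
      (η * (10 ^ 9 * (bhi + 4) ^ 4 * (F + 1)) ≤ 1) →
      (εb * (10 ^ 9 * (F + 1) ^ 2 * (bhi + 4) ^ 3) ≤ 1) →
      (10 ^ 3 + 20 * Real.log (bhi + 5) + Real.log (F + 2) ≤ -Real.log εb) →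
      (blo ≤ B) →
      (B ≤ bhi) →
      (∀ k : ℤ, k < n₀ → ∀ t ∈ Icc 0 T, bv k t = 0 ∧ wv k t = 0 ∧ M0 k t = 0 ∧ M1 k t = 0) →
      (∀ k : ℤ, ContinuousOn (bv k) (Icc 0 T) ∧ ContinuousOn (wv k) (Icc 0 T) ∧
        ContinuousOn (M0 k) (Icc 0 T) ∧ ContinuousOn (M1 k) (Icc 0 T)) →
      (∀ k : ℤ, ContinuousOn (db k) (Icc 0 T) ∧ ContinuousOn (dw k) (Icc 0 T) ∧
        ∀ t ∈ Ioo 0 T, HasDerivAt (bv k) (db k t) t ∧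
        |db k t - R k * (-(bv k t) + G0 k t)| ≤ η * R k * M0 k t ∧
        HasDerivAt (wv k) (dw k t) t ∧ |dw k t - R k * (-(wv k t) + G1 k t)| ≤ η * R k * M1 k t) →
      (∀ k : ℤ, ∀ t ∈ Icc 0 T, |bv k t| ≤ M0 k t ∧ |wv k t| ≤ M1 k t ∧ 0 ≤ M0 k t ∧ 0 ≤ M1 k t) →
      (∀ k : ℤ, ∀ t₁ ∈ Icc 0 T, ∀ t₂ ∈ Icc t₁ T,
        M0 k t₂ ≤ M0 k t₁ * Real.exp (-(θ * R k * (t₂ - t₁))) +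
        R k * ∫ u in t₁..t₂, Real.exp (-(θ * R k * (t₂ - u))) * |G0 k u| ∧
        M1 k t₂ ≤ M1 k t₁ * Real.exp (-(θ * R k * (t₂ - t₁))) +
        R k * ∫ u in t₁..t₂, Real.exp (-(θ * R k * (t₂ - u))) * |G1 k u|) →
      (0 < T) →
      (0 ≤ t₀) →
      (t₀ < S) →
      (S ≤ T) →
      (R n * (S - t₀) ≤ 3) →
      (n₀ ≤ n - 1) →
      (0 ≤ wv (n - 1) t₀ ∧ q ^ 3 * B - 1 ≤ (wv (n - 1) t₀) ^ 2 ∧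
        (wv (n - 1) t₀) ^ 2 ≤ q ^ 3 * B + 1 ∧ 9 / 20 ≤ bv (n - 1) t₀ ∧ bv (n - 1) t₀ ≤ 11 / 20 ∧
        M0 (n - 1) t₀ ≤ 5 * (bhi + 4) ^ 2 ∧ M1 (n - 1) t₀ ≤ 5 * (bhi + 4) ^ 2) →
      (n₀ ≤ n - 2 → ∀ u ∈ Icc t₀ S, |wv (n - 2) u| ≤ 1 / 100) →
      (∀ u ∈ Icc t₀ S, -(1 / 2) ≤ bv n u ∧ bv n u ≤ B + 3 ∧
        B * Real.exp (-(R n * (u - t₀))) - 3 ≤ bv n u) →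
      ∀ u ∈ Icc t₀ S, -(1 / 100) ≤ wv (n - 1) u ∧ (wv (n - 1) u) ^ 2 ≤ q ^ 3 * B + 2 ∧
      -(2 / 5) ≤ bv (n - 1) u ∧ bv (n - 1) u ≤ 17 / 20 ∧
      (t₀ + 2 * (100 + 4 * Real.log (bhi + 5)) / (B * R n) ≤ u →
      |wv (n - 1) u| ≤ 1 / 200 ∧ bv (n - 1) u ≤ 3 / 10) ∧
      M0 (n - 1) u ≤ 6 * (bhi + 4) ^ 2 ∧ M1 (n - 1) u ≤ 6 * (bhi + 4) ^ 2 ∧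
      (1 + ε₀) ^ (-(2 : ℤ)) * R n * ∫ t in t₀..u, (wv (n - 1) t) ^ 2 ≤ 9 / 10 := by
  intro ε₀ D εb θ η F blo bhi q T t₀ S B n₀ n bv wv M0 M1 db dw G0 G1 R hq hR hG0 hG1 hε₀ hε₀' hD
    hθ hθ1 hη hεb hεb6 hblo hF hηreg hεbreg hseed hBlo hBhi hzero hcont hC1 hmaj hrest hT ht₀ hS
    hST hS3 hn1 hInvP hTr hLF
  obtain ⟨hεb1, hB4, hB1, hF0, -, hεbhi, hq1, hq21⟩ :=
    oneStepCore_regime hε₀ hε₀' hεb hεb6 hblo hF hεbreg hBlo hBhi hq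
  have hbhi : 1 ≤ bhi + 4 := by linarith
  have hB0 : 0 ≤ B := by linarith
  obtain ⟨hRpos, -, hκ, -, -, -, hκ45, hκ1, hκq, hq0, hq2⟩ := preBoot_rates hε₀ hε₀' hD hR hq n
  have hRn := hRpos n
  have hθ0 : 0 < θ := by linarith
  obtain ⟨hη9, hη1, hη2, -⟩ := preBoot_eta hη hF0 hbhi hηreg
  obtain ⟨hΛ100, h25, hσI0, hσI, hΛB, hdecay⟩ :=
    preBoot_Lambda hεb hεb1 hF0 hblo hseed hBlo hBhi hκ45
  obtain ⟨hw0, hwlo, hwhi, hblo', hbhi', hM00, hM10⟩ := hInvP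
  set Λ₀ := 100 + 4 * Real.log (bhi + 5) with hΛ₀
  set κ₀ := (1 + ε₀) ^ (-(2 : ℤ)) with hκ₀
  -- slow time of the front
  set S' := R n * (S - t₀) with hS'
  have hS'0 : 0 < S' := mul_pos hRn (by linarith)
  have hST' : t₀ + S' / R n ≤ T := by
    rw [hS', mul_div_cancel_left₀ _ hRn.ne']
    linarith
  obtain ⟨⟨hbc, hm0c, hg0c, he0c, hdb, he0, hm0D⟩, ⟨hwc, hm1c, hg1c, he1c, hdw, he1, hm1D⟩⟩ :=
    handoff_sysPkg (k := n - 1) hG0 hG1 hcont hC1 hmaj hrest hRn hT ht₀ hS'0.le hST'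
  obtain ⟨-, ⟨hwlc, -⟩⟩ :=
    handoff_sysPkg (k := n - 2) hG0 hG1 hcont hC1 hmaj hrest hRn hT ht₀ hS'0.le hST'
  obtain ⟨⟨hbfc, -⟩, -⟩ :=
    handoff_sysPkg (k := n) hG0 hG1 hcont hC1 hmaj hrest hRn hT ht₀ hS'0.le hST'
  obtain ⟨hmem, hpush⟩ := preBoot_push (tb := t₀) (s₁ := S) hRn
  obtain ⟨htime1, htime, ht00⟩ := preBoot_time (tb := t₀) hRn.ne'
  have hdsq : ∀ a : ℝ, (a / (q * Real.sqrt q)) ^ 2 = a ^ 2 / q ^ 3 :=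
    fun a => (preBoot_divsq hq1 a).1
  -- the forcings of the previous pair
  have hG0' : ∀ t, G0 (n - 1) t = -(wv (n - 1) t) ^ 2 +
      (wv (n - 2) t / (q * Real.sqrt q)) ^ 2 - εb * bv (n - 1) t * wv (n - 1) t := by
    intro t
    rw [hG0, hdsq, show n - 1 - 1 = n - 2 by ring]
    ring
  have hG1' : ∀ t, G1 (n - 1) t =
      wv (n - 1) t * (bv (n - 1) t - bv n t / q) + εb * (bv (n - 1) t) ^ 2 := by
    intro t
    rw [hG1, show n - 1 + 1 = n by ring]
  -- regime side conditions of `stub_previousPairTrunc`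
  have hsqB : Real.sqrt B ≤ (bhi + 4) ^ 2 := by
    rw [Real.sqrt_le_left (by positivity), ← pow_mul]
    exact le_trans (by linarith) (le_self_pow₀ hbhi (by norm_num : (2 * 2 : ℕ) ≠ 0))
  have hημ : η * (5 * (bhi + 4) ^ 2 + 2 * Real.sqrt B) ≤ 1 / 100 / 10 := by
    have : η * (5 * (bhi + 4) ^ 2 + 2 * Real.sqrt B) ≤ η * (7 * (bhi + 4) ^ 2) :=
      mul_le_mul_of_nonneg_left (by linarith) hη
    linarith
  have hημ' : η * (5 * (bhi + 4) ^ 2) ≤ 1 / 20 := by linarith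
  have hq4 : q ^ 4 ≤ 11025 / 10000 := by
    rw [show q ^ 4 = (q ^ 2) ^ 2 by ring, hq2]
    have := pow_le_pow_left₀ (by linarith : 0 ≤ 1 + ε₀) (by linarith : 1 + ε₀ ≤ 21 / 20) 2
    linarith [show ((21 : ℝ) / 20) ^ 2 ≤ 11025 / 10000 by norm_num]
  have hq4' : 1 ≤ q ^ 4 := one_le_pow₀ hq1
  -- the neighbours in slow time
  have hwl : ∀ σ ∈ Icc 0 S', |wv (n - 2) (t₀ + σ / R n) / (q * Real.sqrt q)| ≤ 1 / 100 := by
    intro σ hσ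
    refine ((preBoot_divsq hq1 _).2).trans ?_
    by_cases h2 : n₀ ≤ n - 2
    · exact hTr h2 _ (hmem σ hσ)
    · have hm := hmem σ hσ
      rw [(hzero (n - 2) (by omega) _ ⟨ht₀.trans hm.1, hm.2.trans hST⟩).2.1, abs_zero]
      norm_num
  have hfrI : ∀ σ ∈ Icc 0 (min S' (2 * Λ₀ / B)), B * Real.exp (-σ) - 3 ≤ bv n (t₀ + σ / R n) := by
    intro σ hσ
    have hσ' : σ ∈ Icc 0 S' := ⟨hσ.1, hσ.2.trans (min_le_left _ _)⟩
    have := (hLF _ (hmem σ hσ')).2.2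
    rwa [htime] at this
  have hfr : ∀ σ ∈ Icc 0 S', -(1 / 2) ≤ bv n (t₀ + σ / R n) ∧ bv n (t₀ + σ / R n) ≤ B + 3 :=
    fun σ hσ => ⟨(hLF _ (hmem σ hσ)).1, (hLF _ (hmem σ hσ)).2.1⟩
  -- hypotheses of `stub_previousPairTrunc`
  have h1 : ∀ σ ∈ Ioo 0 S', HasDerivAt (fun s => bv (n - 1) (t₀ + s / R n))
      (κ₀ * (-(bv (n - 1) (t₀ + σ / R n)) - (wv (n - 1) (t₀ + σ / R n)) ^ 2 +
        (wv (n - 2) (t₀ + σ / R n) / (q * Real.sqrt q)) ^ 2 -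
        εb * bv (n - 1) (t₀ + σ / R n) * wv (n - 1) (t₀ + σ / R n)) +
        (db (n - 1) (t₀ + σ / R n) -
          R (n - 1) * (-(bv (n - 1) (t₀ + σ / R n)) + G0 (n - 1) (t₀ + σ / R n))) / R n) σ := by
    intro σ hσ
    refine (hdb σ hσ).congr_deriv ?_
    rw [hκ, hG0']
    ring
  have h2 : ∀ σ ∈ Ioo 0 S', HasDerivAt (fun s => wv (n - 1) (t₀ + s / R n))
      (κ₀ * (wv (n - 1) (t₀ + σ / R n) * (bv (n - 1) (t₀ + σ / R n) - bv n (t₀ + σ / R n) / q - 1) +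
        εb * (bv (n - 1) (t₀ + σ / R n)) ^ 2) +
        (dw (n - 1) (t₀ + σ / R n) -
          R (n - 1) * (-(wv (n - 1) (t₀ + σ / R n)) + G1 (n - 1) (t₀ + σ / R n))) / R n) σ := by
    intro σ hσ
    refine (hdw σ hσ).congr_deriv ?_
    rw [hκ, hG1']
    ring
  have h3 : ∀ σ ∈ Icc 0 S', |(db (n - 1) (t₀ + σ / R n) -
      R (n - 1) * (-(bv (n - 1) (t₀ + σ / R n)) + G0 (n - 1) (t₀ + σ / R n))) / R n| ≤
        η * κ₀ * M0 (n - 1) (t₀ + σ / R n) := by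
    intro σ hσ
    have := he0 σ hσ
    rwa [hκ] at this
  have h4 : ∀ σ ∈ Icc 0 S', |(dw (n - 1) (t₀ + σ / R n) -
      R (n - 1) * (-(wv (n - 1) (t₀ + σ / R n)) + G1 (n - 1) (t₀ + σ / R n))) / R n| ≤
        η * κ₀ * M1 (n - 1) (t₀ + σ / R n) := by
    intro σ hσ
    have := he1 σ hσ
    rwa [hκ] at this
  have h5 : ∀ σ ∈ Icc 0 S', 0 ≤ M0 (n - 1) (t₀ + σ / R n) ∧
      M0 (n - 1) (t₀ + σ / R n) ≤ M0 (n - 1) (t₀ + 0 / R n) * Real.exp (-(θ * κ₀ * σ)) +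
        κ₀ * ∫ u in (0 : ℝ)..σ, Real.exp (-(θ * κ₀ * (σ - u))) *
          |-(wv (n - 1) (t₀ + u / R n)) ^ 2 + (wv (n - 2) (t₀ + u / R n) / (q * Real.sqrt q)) ^ 2 -
            εb * bv (n - 1) (t₀ + u / R n) * wv (n - 1) (t₀ + u / R n)| := by
    intro σ hσ
    have := hm0D σ hσ
    simp only [hκ, hG0'] at this
    exact this
  have h6 : ∀ σ ∈ Icc 0 S', 0 ≤ M1 (n - 1) (t₀ + σ / R n) ∧
      M1 (n - 1) (t₀ + σ / R n) ≤ M1 (n - 1) (t₀ + 0 / R n) * Real.exp (-(θ * κ₀ * σ)) +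
        κ₀ * ∫ u in (0 : ℝ)..σ, Real.exp (-(θ * κ₀ * (σ - u))) *
          |wv (n - 1) (t₀ + u / R n) * (bv (n - 1) (t₀ + u / R n) - bv n (t₀ + u / R n) / q) +
            εb * (bv (n - 1) (t₀ + u / R n)) ^ 2| := by
    intro σ hσ
    have := hm1D σ hσ
    simp only [hκ, hG1'] at this
    exact this
  obtain ⟨kA, kB, kC⟩ := stub_previousPairTrunc (fun σ => bv (n - 1) (t₀ + σ / R n))
    (fun σ => wv (n - 1) (t₀ + σ / R n)) (fun σ => bv n (t₀ + σ / R n))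
    (fun σ => M0 (n - 1) (t₀ + σ / R n)) (fun σ => M1 (n - 1) (t₀ + σ / R n))
    (fun σ => wv (n - 2) (t₀ + σ / R n) / (q * Real.sqrt q))
    (fun σ => (db (n - 1) (t₀ + σ / R n) -
      R (n - 1) * (-(bv (n - 1) (t₀ + σ / R n)) + G0 (n - 1) (t₀ + σ / R n))) / R n)
    (fun σ => (dw (n - 1) (t₀ + σ / R n) -
      R (n - 1) * (-(wv (n - 1) (t₀ + σ / R n)) + G1 (n - 1) (t₀ + σ / R n))) / R n)
    B Λ₀ κ₀ q θ η εb (1 / 100) (5 * (bhi + 4) ^ 2) (2 * Λ₀ / B) 10 S' hκ45 hκ1 hq1 hq21 hθ hθ1 hη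
    hεb (by linarith) le_rfl (by positivity) hημ hημ' (by linarith) hσI0 (by linarith)
    (by linarith) le_rfl hS'0 (by linarith) hΛ100 hΛB hdecay hbc hwc hbfc hm0c hm1c
    (hwlc.div_const _) he0c he1c h1 h2 h3 h4 h5 h6 hwl hfrI hfr (by rw [ht00]; linarith)
    (by rw [ht00]; linarith) (by rw [ht00]; exact hw0) (by rw [ht00]; exact hwlo)
    (by rw [ht00]; exact hwhi) (by rw [ht00]; exact hM00) (by rw [ht00]; exact hM10)
  -- the majorants from the Duhamel restart inequalities
  have hκ0 : 0 < κ₀ := by linarith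
  have hM : ∀ σ ∈ Icc 0 S', M0 (n - 1) (t₀ + σ / R n) ≤ 6 * (bhi + 4) ^ 2 ∧
      M1 (n - 1) (t₀ + σ / R n) ≤ 6 * (bhi + 4) ^ 2 := by
    intro σ hσ
    have hsub : Icc 0 σ ⊆ Icc 0 S' := Icc_subset_Icc_right hσ.2
    -- pointwise bounds of the brackets on `[0, σ]`
    have hbnd : ∀ u ∈ Icc 0 σ,
        |-(wv (n - 1) (t₀ + u / R n)) ^ 2 + (wv (n - 2) (t₀ + u / R n) / (q * Real.sqrt q)) ^ 2 -
          εb * bv (n - 1) (t₀ + u / R n) * wv (n - 1) (t₀ + u / R n)| ≤ 24 / 10 * B + 6 ∧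
        |wv (n - 1) (t₀ + u / R n) * (bv (n - 1) (t₀ + u / R n) - bv n (t₀ + u / R n) / q) +
          εb * (bv (n - 1) (t₀ + u / R n)) ^ 2| ≤ (B + 2) / 2 * (B + 4) + 1 := by
      intro u hu
      have hu' := hsub hu
      obtain ⟨-, a2, a3, a4⟩ := kA u hu'
      obtain ⟨f1, f2⟩ := hfr u hu'
      exact pulseBoot_prev_brackets hεb hεb1 hq1 hq21 (by linarith) a2 a3 a4 f1 f2 (hwl u hu')
    have hθκ : 0 < θ * κ₀ := mul_pos hθ0 hκ0
    have hg0 : ContinuousOn (fun u => -(wv (n - 1) (t₀ + u / R n)) ^ 2 +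
        (wv (n - 2) (t₀ + u / R n) / (q * Real.sqrt q)) ^ 2 -
        εb * bv (n - 1) (t₀ + u / R n) * wv (n - 1) (t₀ + u / R n)) (Icc 0 σ) :=
      (hg0c.mono hsub).congr fun u _ => (hG0' _).symm
    have hg1 : ContinuousOn (fun u => wv (n - 1) (t₀ + u / R n) *
        (bv (n - 1) (t₀ + u / R n) - bv n (t₀ + u / R n) / q) +
        εb * (bv (n - 1) (t₀ + u / R n)) ^ 2) (Icc 0 σ) :=
      (hg1c.mono hsub).congr fun u _ => (hG1' _).symm
    have hC0 : 0 ≤ 24 / 10 * B + 6 := by linarith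
    have hC1 : 0 ≤ (B + 2) / 2 * (B + 4) + 1 := by
      have := mul_nonneg (by linarith : 0 ≤ (B + 2) / 2) (by linarith : 0 ≤ B + 4)
      linarith
    have m0 := levelOnePre_majorant hθκ hC0 hκ0.le hσ.1 hg0 (fun u hu => (hbnd u hu).1)
      (h5 σ hσ).2
    have m1 := levelOnePre_majorant hθκ hC1 hκ0.le hσ.1 hg1 (fun u hu => (hbnd u hu).2)
      (h6 σ hσ).2
    rw [ht00] at m0 m1
    have hex : Real.exp (-(θ * κ₀ * σ)) ≤ 1 :=
      Real.exp_le_one_iff.2 (by have := mul_nonneg hθκ.le hσ.1; linarith)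
    obtain ⟨-, -, hM0nn, hM1nn⟩ := hmaj (n - 1) t₀ ⟨ht₀, by linarith⟩
    have hM0e := mul_le_of_le_one_right hM0nn hex
    have hM1e := mul_le_of_le_one_right hM1nn hex
    have hcancel : ∀ C : ℝ, 0 ≤ C → κ₀ * (C / (θ * κ₀)) ≤ 2 * C := by
      intro C hC
      have e : κ₀ * (C / (θ * κ₀)) = C / θ := by
        field_simp
      rw [e, div_le_iff₀ hθ0]
      have := mul_le_mul_of_nonneg_left hθ hC
      linarith
    have hc0 := hcancel _ hC0
    have hc1 := hcancel _ hC1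
    have hsq : (bhi + 4) ^ 2 = bhi ^ 2 + 8 * bhi + 16 := by ring
    have hBB : B ^ 2 ≤ bhi ^ 2 := pow_le_pow_left₀ hB0 hBhi 2
    have e2 : (B + 2) / 2 * (B + 4) = (B ^ 2 + 6 * B + 8) / 2 := by ring
    have hbhi2 : 0 ≤ bhi ^ 2 := sq_nonneg _
    constructor <;> linarith
  -- back to real time
  intro u hu
  have hσu : R n * (u - t₀) ∈ Icc 0 S' :=
    ⟨mul_nonneg hRn.le (by linarith [hu.1]), mul_le_mul_of_nonneg_left (by linarith [hu.2]) hRn.le⟩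
  have hut : t₀ + R n * (u - t₀) / R n = u := htime1 u
  obtain ⟨a1, a2, a3, a4⟩ := kA _ hσu
  obtain ⟨m0, m1⟩ := hM _ hσu
  have kC' := kC _ hσu
  rw [hut] at a1 a2 a3 a4 m0 m1
  refine ⟨by linarith, a2, a3, a4, fun hI => ?_, m0, m1, ?_⟩
  · have hσI' : 2 * Λ₀ / B ≤ R n * (u - t₀) := by
      have h1 : 2 * Λ₀ / (B * R n) ≤ u - t₀ := by linarith
      have h2 := mul_le_mul_of_nonneg_left h1 hRn.le
      have hB0' : B ≠ 0 := by positivity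
      have e : R n * (2 * Λ₀ / (B * R n)) = 2 * Λ₀ / B := by
        field_simp
      linarith
    obtain ⟨b1, b2⟩ := kB _ ⟨hσI', hσu.2⟩
    rw [hut] at b1 b2
    exact ⟨by linarith, b2⟩
  · have e1 : ∫ v in (0 : ℝ)..R n * (u - t₀), (wv (n - 1) (t₀ + v / R n)) ^ 2 =
        R n * ∫ t in t₀..u, (wv (n - 1) t) ^ 2 := by
      rw [← integral_rescale (fun t => (wv (n - 1) t) ^ 2) hRn.ne' 0 (R n * (u - t₀)),
        intervalIntegral.integral_const_mul, ht00, hut]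
    rw [e1, ← mul_assoc] at kC'
    exact kC'

end Summit.NavierStokesRegularity.NavierStokesRegularity.Theorems.PerpetualPumpAveragedTypeIBlowup

end
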